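import Summits.AtomisticToContinuum.BoseEinsteinCondensation.Theorems.BECInsertionCorrectorCorrectorClosureDriftMode
import HarnessLib

/-!
# Line `insertion-mode-gaussian-domination`, aux — drift-mode `H₋₁` bounds for the two real quadratures
# (crux `BECInsertionCorrector.CorrectorClosure`, item stmt-AtomisticToContinuum-12058; supports, does not close)

The `ω = 0` and `ω = −π/2` instances of `driftMode_hMinusOneSqW_le_shift`
(`Theorems/BECInsertionCorrectorCorrectorClosureDriftMode.lean`): the cosine drift mode `(Σⱼ cos θⱼ p·∇ⱼΘ)/Θ` is
bounded in `H₋₁(Θ²)` by the sine density mode and the f-sum constant, the sine drift mode by the cosine density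
mode (`cos(θ − π/2) = sin θ`, `sin(θ − π/2) = −cos θ`, `‖−g‖₋₁ = ‖g‖₋₁`). With K1 (`stub_firstOrderInput`) both
quadratures of the bath drift mode `Σⱼ e^{-ip·xⱼ} p·∇ⱼ log Θ₀` are `≤ ¼(|p|²√(B₁N/max(ρa,p²)) + √(N|p|²))²`.
References (shape only): C. Kipnis, S. R. S. Varadhan, Comm. Math. Phys. 104 (1986), (1.14).
-/

noncomputable section

namespace Summit.AtomisticToContinuum.BoseEinsteinCondensation.Theorems.CorrectorClosure.InsertionModeGaussianDomination

open MeasureTheory Filter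
open scoped ENNReal NNReal BigOperators
open Literature.MathematicalPhysics.QuantumManyBody.BoseGas

variable {N : ℕ}

/-- **Drift-mode `H₋₁` bound, cosine quadrature** (`ω = 0`): if `‖Σⱼ sin θⱼ‖²₋₁ ≤ b` then
`‖(Σⱼ cos θⱼ p·∇ⱼΘ)/Θ‖²₋₁ ≤ ¼(|p|²√b + √(N|p|²∫Θ²))²`. With the f-sum rule this is the `H₋₁` reading of
`Σⱼ e^{-ip·xⱼ} p·∇ⱼΘ = [(H_N−E_N)(ρ_pΘ) − |p|²ρ_pΘ]/(2i)`. [cite: KipnisVaradhan1986, (1.14)] -/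
theorem driftMode_cos_hMinusOneSqW_le {L : ℝ} (hL : 0 < L) {Θ : Config N → ℝ}
    (hΘC : ContDiff ℝ 1 Θ) (hΘper : IsLatticePeriodic L Θ) (n : Fin 3 → ℤ) {b : ℝ} (hb : 0 ≤ b)
    (hS : hMinusOneSqW L Θ
        (fun X => ∑ j : Fin N, Real.sin (2 * Real.pi / L * ∑ i, (n i : ℝ) * X j i)) ≤
      ENNReal.ofReal b) :
    hMinusOneSqW L Θ (fun X =>
        (∑ j : Fin N, Real.cos (2 * Real.pi / L * ∑ i, (n i : ℝ) * X j i) *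
          ∑ k : Fin 3, 2 * Real.pi / L * (n k : ℝ) * pderiv j k Θ X) / Θ X) ≤
      ENNReal.ofReal
        (((∑ k : Fin 3, (2 * Real.pi / L * (n k : ℝ)) ^ 2) * Real.sqrt b +
            Real.sqrt (N * (∑ k : Fin 3, (2 * Real.pi / L * (n k : ℝ)) ^ 2) *
              ∫ X in cellN N L, Θ X ^ 2)) ^ 2 / 4) := by
  have h := driftMode_hMinusOneSqW_le_shift hL hΘC hΘper n 0 hb (by simpa only [add_zero] using hS)
  simpa only [add_zero] using h

/-- **Drift-mode `H₋₁` bound, sine quadrature** (`ω = −π/2`): if `‖Σⱼ cos θⱼ‖²₋₁ ≤ b` then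
`‖(Σⱼ sin θⱼ p·∇ⱼΘ)/Θ‖²₋₁ ≤ ¼(|p|²√b + √(N|p|²∫Θ²))²` (`cos(θ − π/2) = sin θ`, `sin(θ − π/2) = −cos θ`,
`‖−g‖₋₁ = ‖g‖₋₁`). [cite: KipnisVaradhan1986, (1.14)] -/
theorem driftMode_sin_hMinusOneSqW_le {L : ℝ} (hL : 0 < L) {Θ : Config N → ℝ}
    (hΘC : ContDiff ℝ 1 Θ) (hΘper : IsLatticePeriodic L Θ) (n : Fin 3 → ℤ) {b : ℝ} (hb : 0 ≤ b)
    (hC : hMinusOneSqW L Θ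
        (fun X => ∑ j : Fin N, Real.cos (2 * Real.pi / L * ∑ i, (n i : ℝ) * X j i)) ≤
      ENNReal.ofReal b) :
    hMinusOneSqW L Θ (fun X =>
        (∑ j : Fin N, Real.sin (2 * Real.pi / L * ∑ i, (n i : ℝ) * X j i) *
          ∑ k : Fin 3, 2 * Real.pi / L * (n k : ℝ) * pderiv j k Θ X) / Θ X) ≤
      ENNReal.ofReal
        (((∑ k : Fin 3, (2 * Real.pi / L * (n k : ℝ)) ^ 2) * Real.sqrt b +
            Real.sqrt (N * (∑ k : Fin 3, (2 * Real.pi / L * (n k : ℝ)) ^ 2) *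
              ∫ X in cellN N L, Θ X ^ 2)) ^ 2 / 4) := by
  -- `Σ sin(θ − π/2) = −Σ cos θ`, same `H₋₁` norm
  have hS : hMinusOneSqW L Θ
      (fun X => ∑ j : Fin N, Real.sin (2 * Real.pi / L * ∑ i, (n i : ℝ) * X j i + -(Real.pi / 2))) ≤
      ENNReal.ofReal b := by
    have e : (fun X => ∑ j : Fin N,
        Real.sin (2 * Real.pi / L * ∑ i, (n i : ℝ) * X j i + -(Real.pi / 2))) =
        (-1 : ℝ) • fun X : Config N =>
          ∑ j : Fin N, Real.cos (2 * Real.pi / L * ∑ i, (n i : ℝ) * X j i) := by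
      funext X
      simp only [Pi.smul_apply, smul_eq_mul, ← sub_eq_add_neg, Real.sin_sub_pi_div_two,
        Finset.sum_neg_distrib, neg_mul, one_mul]
    rw [e, hMinusOneSqW_smul]
    simpa using hC
  have h := driftMode_hMinusOneSqW_le_shift hL hΘC hΘper n (-(Real.pi / 2)) hb hS
  have e2 : (fun X => (∑ j : Fin N,
      Real.cos (2 * Real.pi / L * ∑ i, (n i : ℝ) * X j i + -(Real.pi / 2)) *
        ∑ k : Fin 3, 2 * Real.pi / L * (n k : ℝ) * pderiv j k Θ X) / Θ X) =
      fun X => (∑ j : Fin N, Real.sin (2 * Real.pi / L * ∑ i, (n i : ℝ) * X j i) *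
        ∑ k : Fin 3, 2 * Real.pi / L * (n k : ℝ) * pderiv j k Θ X) / Θ X := by
    funext X
    simp only [← sub_eq_add_neg, Real.cos_sub_pi_div_two]
  rw [e2] at h
  exact h

end Summit.AtomisticToContinuum.BoseEinsteinCondensation.Theorems.CorrectorClosure.InsertionModeGaussianDomination

end
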